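import Mathlib
import HarnessLib
import Literature.NumberTheory.Automorphic.UnitaryCoherentGaloisRep
import Summits.Langlands.Langlands.Theses.QuadraticWindow

/-!
# The crux `GaloisRepOfUnitaryLDS` of route `QuadraticWindow` (stmt-Langlands-15129): bridge to the
# named fact and the unconditional reductions

The route item `Summit.Langlands.Langlands.Theses.QuadraticWindow.GaloisRepOfUnitaryLDS` is, fully
qualified, VERBATIM the body of the named literature fact
`Literature.NumberTheory.Automorphic.GoldringKoskivirta2019_galoisRep_unitary` (Goldring–Koskivirta,
Invent. Math. 217 (2019), Thm. 3.5.5, LDS unitary case, rendered for Mok's quasi-split `U_{K/F₀}(N)`).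
This file records, kernel-checked:

* `galoisRepOfUnitaryLDS_iff_goldringKoskivirta` — the two propositions are definitionally equal
  (`Iff.rfl`), so a discharge of either closes the other in one line;
* `GaloisRepOfUnitaryLDS_of_goldringKoskivirta` — the CONDITIONAL proof of the item from the fact
  (the form consumed by `stub_gkPlacewise_ratControl` of line grs-explicit-descent of `HostInducedRep`,
  `Theorems/QuadraticWindowHostInducedRepGkPlacewise.lean`), and the converse
  `goldringKoskivirta_of_galoisRepOfUnitaryLDS` (a proof of the crux discharges the fact for every
  Literature-side consumer);
* `GaloisRepOfUnitaryLDS_rank_zero` — the degenerate rank `N = 0` of the item, unconditionally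
  (from `GoldringKoskivirta2019_galoisRep_unitary_rank_zero`);
* `GaloisRepOfUnitaryLDS_of_pos_rank` — a discharge of the item may assume `0 < N`;
* `GaloisRepOfUnitaryLDS_of_ladicApproxPackages` — the whole item from `ℓ`-ADIC APPROXIMATION
  PACKAGES: if every datum `(F₀, K, cK, N, ℓ, ι, σ)` satisfying the item's hypotheses admits a finite
  bad set `S` avoiding the places of the conclusion, base-change Satake parameters `β₀` of `σ` off `S`
  with multiplicity one, a finite `E/ℚ_ℓ` containing the coefficients of the predicted Frobenius
  polynomials, and for every `m` a continuous `Γ_K → GL_N(ℚ̄_ℓ)` unramified off `S ∪ {u ∣ ℓ}` whose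
  Frobenius polynomials are within `ℓ^{-m}` of the predicted ones, then the item holds.  This is
  Goldring–Koskivirta §11.1, Case [LDS], last step (Taylor 1991, pseudo-representations), i.e. the
  proved tree theorem `GoldringKoskivirta2019_galoisRep_unitary_of_ladicApprox` applied datum by
  datum; it isolates what a line on this crux has to produce — the approximation package (op. cit.
  Thm. 10.5.1 + Cor. 2.2.2 + [HLTT] Cor. 1.3) and Satake multiplicity one — and nothing on the
  Galois side.

No new named fact is introduced; nothing here closes the item (the conditional proof is recorded as
such).  Sources: W. Goldring, J.-S. Koskivirta, Invent. Math. 217 (2019), Thm. 3.5.5 and §11.1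
(arXiv:1507.05032, pp. 19, 40); R. Taylor, Duke Math. J. 63 (1991), §1.
-/

open Literature.NumberTheory.GaloisRepresentations Literature.NumberTheory.Automorphic
open IsDedekindDomain NumberField

set_option linter.dupNamespace false -- project-wide option (lakefile weak.linter.dupNamespace); `Summit.Langlands.Langlands` is the mandated namespace

namespace Summit.Langlands.Langlands.Theorems

/-- The route crux `GaloisRepOfUnitaryLDS` and the named fact
`GoldringKoskivirta2019_galoisRep_unitary` are the same proposition (definitionally: the item is the
fully qualified body of the fact). [folklore] -/
theorem galoisRepOfUnitaryLDS_iff_goldringKoskivirta :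
    Summit.Langlands.Langlands.Theses.QuadraticWindow.GaloisRepOfUnitaryLDS ↔
      GoldringKoskivirta2019_galoisRep_unitary :=
  Iff.rfl

/-- **Conditional proof of the crux** from the named fact (Goldring–Koskivirta 2019, Thm. 3.5.5, as
vendored in `Literature.NumberTheory.Automorphic.UnitaryCoherentGaloisRep`).  Conditional on an
unproved named fact; it does not close the item. [cite: GoldringKoskivirta2019, Thm. 3.5.5 (p. 19)] -/
theorem GaloisRepOfUnitaryLDS_of_goldringKoskivirta (h : GoldringKoskivirta2019_galoisRep_unitary) :
    Summit.Langlands.Langlands.Theses.QuadraticWindow.GaloisRepOfUnitaryLDS :=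
  h

/-- Conversely, a proof of the crux discharges the named fact (so every Literature-side consumer of
`GoldringKoskivirta2019_galoisRep_unitary`, e.g. `stub_gkPlacewise_ratControl`, becomes
unconditional the day the crux is proved). [folklore] -/
theorem goldringKoskivirta_of_galoisRepOfUnitaryLDS
    (h : Summit.Langlands.Langlands.Theses.QuadraticWindow.GaloisRepOfUnitaryLDS) :
    GoldringKoskivirta2019_galoisRep_unitary :=
  h

/-- **The degenerate rank `N = 0` of the crux, unconditionally**: for `σ` on `U_{K/F₀}(0)` the
trivial `Γ_K → GL_0(ℚ̄_ℓ)` is semisimple, unramified everywhere, and has the predicted (empty-product)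
Frobenius polynomial at every base-change Satake parameter (which has `0` entries).  The hypotheses
at infinity and at `ℓ` of the item are not needed. [folklore] -/
theorem GaloisRepOfUnitaryLDS_rank_zero
    (F₀ K : Type) [Field F₀] [NumberField F₀] [Field K] [NumberField K] [Algebra F₀ K]
    (cK : K ≃ₐ[F₀] K) (ℓ : ℕ) [Fact ℓ.Prime] (ι : PadicAlgCl ℓ ≃+* ℂ)
    (hcptK : isCompact_glFiniteIntegralLevel 0 K)
    (σ : UnitaryGroup.CuspidalAutomorphicRepData F₀ K cK 0 hcptK) :
    ∃ r : FramedGaloisRep K (PadicAlgCl ℓ) 0, r.toGaloisRep.IsSemisimple ∧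
      ∀ (u : HeightOneSpectrum (𝓞 K)) (β : Multiset ℂ), ((ℓ : ℕ) : 𝓞 K) ∉ u.asIdeal →
        (∀ u' : HeightOneSpectrum (𝓞 K), u'.asIdeal.under ℤ = u.asIdeal.under ℤ →
          u'.asIdeal.ramificationIdx ℤ = 1 ∧ UnitaryGroup.IsUnramifiedAt F₀ K cK 0 hcptK σ.1 u') →
        UnitaryGroup.HasBaseChangeSatakeAt F₀ K cK 0 hcptK σ.1 u β →
          r.IsUnramifiedAt u ∧ r.HasFrobCharpolyAt u (arithFrobPolyOfSatake ι u.residueCard 0 β) := by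
  obtain ⟨r, hr, hr'⟩ := GoldringKoskivirta2019_galoisRep_unitary_rank_zero F₀ K cK ℓ ι hcptK σ
  exact ⟨r, hr, fun u β _ _ hβ ↦ hr' u β hβ⟩

/-- **Reduction of the crux to positive rank**: `GaloisRepOfUnitaryLDS` quantifies over every
`N : ℕ`; its case `N = 0` is `GaloisRepOfUnitaryLDS_rank_zero`, so the crux follows from its own
restriction to `0 < N` (the genuine content: `m = N ≥ 1`, `V = K^N ≠ 0`, in Goldring–Koskivirta,
Thm. 3.5.5). [folklore] -/
theorem GaloisRepOfUnitaryLDS_of_pos_rank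
    (h : ∀ (F₀ K : Type) [Field F₀] [NumberField F₀] [Field K] [NumberField K] [Algebra F₀ K]
      (cK : K ≃ₐ[F₀] K), IsTotallyReal F₀ → Module.finrank F₀ K = 2 → ∀ (hc : cK ≠ 1),
      IsTotallyComplex K → ∀ (N : ℕ), 0 < N → ∀ (ℓ : ℕ) [Fact ℓ.Prime] (ι : PadicAlgCl ℓ ≃+* ℂ)
      (hcptK : isCompact_glFiniteIntegralLevel N K)
      (σ : UnitaryGroup.CuspidalAutomorphicRepData F₀ K cK N hcptK),
      (∀ (w : {w : InfinitePlace K // w.IsComplex}) (hw : cK • w.1 = w.1),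
        ∃ (p q : ℕ) (d : LDSDatum p q),
          UnitaryGroup.IsNondegenerateLimitOfDiscreteSeriesAt F₀ K cK N (StdForm.antidiagonal N)
            hcptK σ.1 hw hc d) →
      (∀ u : HeightOneSpectrum (𝓞 K), ((ℓ : ℕ) : 𝓞 K) ∈ u.asIdeal →
        u.asIdeal.ramificationIdx ℤ = 1 ∧ UnitaryGroup.IsUnramifiedAt F₀ K cK N hcptK σ.1 u) →
      ∃ r : FramedGaloisRep K (PadicAlgCl ℓ) N, r.toGaloisRep.IsSemisimple ∧
        ∀ (u : HeightOneSpectrum (𝓞 K)) (β : Multiset ℂ), ((ℓ : ℕ) : 𝓞 K) ∉ u.asIdeal →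
          (∀ u' : HeightOneSpectrum (𝓞 K), u'.asIdeal.under ℤ = u.asIdeal.under ℤ →
            u'.asIdeal.ramificationIdx ℤ = 1 ∧
              UnitaryGroup.IsUnramifiedAt F₀ K cK N hcptK σ.1 u') →
          UnitaryGroup.HasBaseChangeSatakeAt F₀ K cK N hcptK σ.1 u β →
            r.IsUnramifiedAt u ∧
              r.HasFrobCharpolyAt u (arithFrobPolyOfSatake ι u.residueCard N β)) :
    Summit.Langlands.Langlands.Theses.QuadraticWindow.GaloisRepOfUnitaryLDS :=
  GoldringKoskivirta2019_galoisRep_unitary_of_pos_rank h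

/-- **The crux from `ℓ`-adic approximation packages** (Goldring–Koskivirta 2019, §11.1, Case
[LDS], last step: "the compositions `θ_n ∘ R` form a `𝔭`-adic system of pseudo-representations …
by [Taylor 1991] … the trace of a unique true, semisimple representation satisfying the
desiderata").  Suppose that for every datum of the item — `K/F₀` totally complex quadratic over
totally real with involution `cK ≠ 1`, `σ` cuspidal on `U_{K/F₀}(N)` which is a non-degenerate limit
of discrete series at every real place, `ℓ ∉ Ram(G) ∪ Ram(σ)` — there are a finite `E/ℚ_ℓ`, a
finite set `S` of finite places of `K` containing no place of the conclusion (`u ∤ ℓ` over a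
rational prime above which `K/ℚ` is unramified and `σ` unramified), parameters `β₀ u` such that
every base-change Satake parameter of `σ` at `u ∉ S` equals `β₀ u` (Satake multiplicity one), with
the coefficients of the predicted polynomials `arithFrobPolyOfSatake ι q_u N (β₀ u)` in `E`, and for
every `m` a continuous `ρ'_m : Γ_K → GL_N(ℚ̄_ℓ)` unramified at every `u ∉ S`, `u ∤ ℓ`, with a
Frobenius characteristic polynomial there within `ℓ^{-m}` of the predicted one.  Then
`GaloisRepOfUnitaryLDS` holds: datum by datum this is the proved
`GoldringKoskivirta2019_galoisRep_unitary_of_ladicApprox` (density of Frobenii, uniform limits,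
Taylor's theorem on pseudo-representations, Newton's identities).  The hypothesis is what the
coherent cohomology of the unitary Shimura variety delivers in the source (op. cit. Thm. 10.5.1 with
Cor. 2.2.2 and [HLTT] Cor. 1.3; single-approximant form, see the caveat in
`Literature.NumberTheory.Automorphic.UnitaryCoherentGaloisRep`); it is not proved here.
[cite: GoldringKoskivirta2019, §11.1 (arXiv p. 40), proof of Thm. 3.5.5, Case LDS] -/
theorem GaloisRepOfUnitaryLDS_of_ladicApproxPackages
    (h : ∀ (F₀ K : Type) [Field F₀] [NumberField F₀] [Field K] [NumberField K] [Algebra F₀ K]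
      (cK : K ≃ₐ[F₀] K), IsTotallyReal F₀ → Module.finrank F₀ K = 2 → ∀ (hc : cK ≠ 1),
      IsTotallyComplex K → ∀ (N : ℕ) (ℓ : ℕ) [Fact ℓ.Prime] (ι : PadicAlgCl ℓ ≃+* ℂ)
      (hcptK : isCompact_glFiniteIntegralLevel N K)
      (σ : UnitaryGroup.CuspidalAutomorphicRepData F₀ K cK N hcptK),
      (∀ (w : {w : InfinitePlace K // w.IsComplex}) (hw : cK • w.1 = w.1),
        ∃ (p q : ℕ) (d : LDSDatum p q),
          UnitaryGroup.IsNondegenerateLimitOfDiscreteSeriesAt F₀ K cK N (StdForm.antidiagonal N)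
            hcptK σ.1 hw hc d) →
      (∀ u : HeightOneSpectrum (𝓞 K), ((ℓ : ℕ) : 𝓞 K) ∈ u.asIdeal →
        u.asIdeal.ramificationIdx ℤ = 1 ∧ UnitaryGroup.IsUnramifiedAt F₀ K cK N hcptK σ.1 u) →
      ∃ (E : IntermediateField ℚ_[ℓ] (PadicAlgCl ℓ)) (_ : FiniteDimensional ℚ_[ℓ] E)
        (S : Set (HeightOneSpectrum (𝓞 K))) (_ : S.Finite)
        (β₀ : HeightOneSpectrum (𝓞 K) → Multiset ℂ),
        (∀ u : HeightOneSpectrum (𝓞 K), ((ℓ : ℕ) : 𝓞 K) ∉ u.asIdeal →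
          (∀ u' : HeightOneSpectrum (𝓞 K), u'.asIdeal.under ℤ = u.asIdeal.under ℤ →
            u'.asIdeal.ramificationIdx ℤ = 1 ∧
              UnitaryGroup.IsUnramifiedAt F₀ K cK N hcptK σ.1 u') →
          u ∉ S) ∧
        (∀ u ∉ S, ∀ β : Multiset ℂ,
          UnitaryGroup.HasBaseChangeSatakeAt F₀ K cK N hcptK σ.1 u β → β = β₀ u) ∧
        (∀ u ∉ S, ∀ k : ℕ, (arithFrobPolyOfSatake ι u.residueCard N (β₀ u)).coeff k ∈ E) ∧
        (∀ m : ℕ, ∃ ρ' : FramedGaloisRep K (PadicAlgCl ℓ) N, ∀ u ∉ S,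
          ((ℓ : ℕ) : 𝓞 K) ∉ u.asIdeal → ρ'.IsUnramifiedAt u ∧ ∃ Q : Polynomial (PadicAlgCl ℓ),
            ρ'.HasFrobCharpolyAt u Q ∧ ∀ k : ℕ,
              ‖Q.coeff k - (arithFrobPolyOfSatake ι u.residueCard N (β₀ u)).coeff k‖ ≤
                (ℓ : ℝ) ^ (-(m : ℤ)))) :
    Summit.Langlands.Langlands.Theses.QuadraticWindow.GaloisRepOfUnitaryLDS := by
  intro F₀ K _ _ _ _ _ cK hF₀ hK hc hKc N ℓ _ ι hcptK σ hLDS hℓ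
  obtain ⟨E, _, S, hS, β₀, hgood, hβ₀, hE, happrox⟩ :=
    h F₀ K cK hF₀ hK hc hKc N ℓ ι hcptK σ hLDS hℓ
  exact GoldringKoskivirta2019_galoisRep_unitary_of_ladicApprox ι σ E S hS β₀ hgood hβ₀ hE happrox

end Summit.Langlands.Langlands.Theorems
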